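import Summits.KontsevichZagierPeriods.KontsevichZagierPeriods.Theorems.RootDecompRelativeModAbsoluteAngleFoldP7

/-! # `RootDecompRelativeModAbsoluteAngleFoldP8` — part 8/9 of the mechanical ≤400-line split of `af_src.lean` (sha256 2a2742458ba4dd14…)
Source: decomp-kz lens-3 g14 AngleFold.lean @5fd37862 (lint-fixed copy @30e24be4 by writer g8 per critic g6-12): ANGLE ADDITION IN FAMILIES — angleCellwiseFoldAt_one : AngleCellwiseFoldAt 1 PROVED (critic CLEARED g6-12 l.1335); --supports stmt-KontsevichZagierPeriods-30572.
Split by census-1 g10 `gen/splitlean.py`: scopes re-opened with their `open`/`variable`/`set_option` context; mathematics and declaration order unchanged. -/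

noncomputable section
open Set MeasureTheory
open Literature.NumberTheory.Transcendental Literature.ModelTheory.ExponentialFields
namespace Summit.KontsevichZagierPeriods.RootDecompRelativeModAbsolute.Rung30571.RegularisedLogLayer.CylLog.Leaf.G13
namespace AngleFold

/-- **Interval cells** (copy of `CircleDescent.exists_interval_cells`, arbitrary finite index): an open `ℚ`-sa `G ⊆ ℝ¹`
is a.e. a finite disjoint union of open convex `ℚ`-sa cells, each inside or disjoint from each `Zᵢ`. -/
theorem interval_cells {ι : Type*} [Fintype ι] {G : Set (Fin 1 → ℝ)} (hG : IsSemialgebraic ℚ G)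
    (Z : ι → Set (Fin 1 → ℝ)) (hZ : ∀ i, IsSemialgebraic ℚ (Z i)) :
    ∃ (B : ℕ) (T : Fin B → Set (Fin 1 → ℝ)),
      (∀ b, IsSemialgebraic ℚ (T b) ∧ IsOpen (T b) ∧ Convex ℝ (T b) ∧ T b ⊆ G) ∧
      Pairwise (Function.onFun Disjoint T) ∧ volume (G \ ⋃ b, T b) = 0 ∧
      ∀ b i, T b ⊆ Z i ∨ Disjoint (T b) (Z i) := by
  classical
  set F : Finset (Set (Fin 1 → ℝ)) := insert G (Finset.univ.image Z) with hF
  have hFsa : ∀ s ∈ F, IsSemialgebraic ℚ s := by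
    intro s hs
    rcases Finset.mem_insert.mp hs with rfl | hs
    · exact hG
    · obtain ⟨i, -, rfl⟩ := Finset.mem_image.mp hs
      exact hZ i
  obtain ⟨𝒮, h𝒮, hadapt⟩ := IsSemialgebraic.exists_cylindricalDecomposition_holds (k := ℚ) F hFsa
  have hpart := h𝒮.isPartition
  have hsa𝒮 := h𝒮.isSemialgebraic
  obtain ⟨𝒮₀, h𝒮₀, l, ξ, -, -, -, hcells⟩ := h𝒮.exists_isCylinderStack
  have h𝒮₀' : 𝒮₀ = {univ} := (isCylindricalDecomposition_zero (k := ℚ)).mp h𝒮₀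
  set x₀ : Fin 0 → ℝ := finZeroElim with hx₀
  have hcell : ∀ T ∈ 𝒮, (∃ j, T ⊆ {z : Fin 1 → ℝ | z (Fin.last 0) = ξ univ j x₀}) ∨
      (IsOpen T ∧ Convex ℝ T) := by
    intro T hT
    obtain ⟨S, hS, hT'⟩ := (hcells T).mp hT
    rw [h𝒮₀', Finset.mem_singleton] at hS
    subst hS
    rcases hT' with ⟨j, rfl⟩ | ⟨j, rfl⟩
    · left
      refine ⟨j, fun z hz => ?_⟩
      have h2 := (mem_graphOver_iff.mp hz).2
      rw [Subsingleton.elim (Fin.init z) x₀] at h2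
      exact h2
    · right
      set I : Set ℝ := {t : ℝ | bandLower (ξ univ) j x₀ < (t : EReal) ∧ (t : EReal) < bandUpper (ξ univ) j x₀}
        with hI
      have hTeq : bandOver univ (ξ univ) j = (fun z : Fin (0 + 1) → ℝ => z (Fin.last 0)) ⁻¹' I := by
        ext z
        rw [mem_bandOver_iff, Subsingleton.elim (Fin.init z) x₀]
        simp [hI]
      have hIo : IsOpen I := by
        have : I = (fun t : ℝ => (t : EReal)) ⁻¹' Set.Ioo (bandLower (ξ univ) j x₀) (bandUpper (ξ univ) j x₀) := rfl
        rw [this]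
        exact isOpen_Ioo.preimage continuous_coe_real_ereal
      have hIc : Convex ℝ I := by
        refine Set.OrdConnected.convex ⟨fun a ha b hb t ht => ⟨?_, ?_⟩⟩
        · exact lt_of_lt_of_le ha.1 (EReal.coe_le_coe_iff.mpr ht.1)
        · exact lt_of_le_of_lt (EReal.coe_le_coe_iff.mpr ht.2) hb.2
      rw [hTeq]
      refine ⟨hIo.preimage (continuous_apply _), ?_⟩
      intro z hz w hw a b ha hb hab
      have h1 := hIc hz hw ha hb hab
      simpa [Pi.add_apply, Pi.smul_apply, smul_eq_mul] using h1
  set 𝒯 := 𝒮.filter (fun T => T ⊆ G ∧ IsOpen T ∧ Convex ℝ T) with h𝒯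
  have hmem : ∀ b : Fin 𝒯.card, ((𝒯.equivFin.symm b : 𝒯) : Set (Fin 1 → ℝ)) ∈ 𝒮 ∧
      ((𝒯.equivFin.symm b : 𝒯) : Set (Fin 1 → ℝ)) ⊆ G ∧ IsOpen ((𝒯.equivFin.symm b : 𝒯) : Set (Fin 1 → ℝ)) ∧
      Convex ℝ ((𝒯.equivFin.symm b : 𝒯) : Set (Fin 1 → ℝ)) := fun b =>
    Finset.mem_filter.mp (𝒯.equivFin.symm b).2
  refine ⟨𝒯.card, fun b => ((𝒯.equivFin.symm b : 𝒯) : Set (Fin 1 → ℝ)),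
    fun b => ⟨hsa𝒮 _ (hmem b).1, (hmem b).2.2.1, (hmem b).2.2.2, (hmem b).2.1⟩, ?_, ?_, fun b i => ?_⟩
  · intro b b' hbb'
    have hne : ((𝒯.equivFin.symm b : 𝒯) : Set (Fin 1 → ℝ)) ≠ (𝒯.equivFin.symm b' : 𝒯) := fun h =>
      hbb' (𝒯.equivFin.symm.injective (Subtype.ext h))
    exact hpart.pairwiseDisjoint (Finset.mem_coe.mpr (hmem b).1) (Finset.mem_coe.mpr (hmem b').1) hne
  · have hN : volume (⋃ j : Fin (l univ), {z : Fin 1 → ℝ | z (Fin.last 0) = ξ univ j x₀}) = 0 :=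
      measure_iUnion_null fun j => KZ.volume_setOf_last_eq_zero (n := 0) _
    refine measure_mono_null (fun x hx => ?_) hN
    obtain ⟨hxG, hxT⟩ := hx
    obtain ⟨𝒞, h𝒞𝒮, hG𝒞⟩ := hadapt G (Finset.mem_insert_self _ _)
    have hx' : x ∈ ⋃₀ (𝒞 : Set (Set (Fin 1 → ℝ))) := by rw [hG𝒞]; exact hxG
    obtain ⟨T', hT'𝒞, hxT'⟩ := Set.mem_sUnion.mp hx'
    have hT'𝒞' : T' ∈ 𝒞 := Finset.mem_coe.mp hT'𝒞
    have hT'𝒮 : T' ∈ 𝒮 := h𝒞𝒮 hT'𝒞'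
    have hT'G : T' ⊆ G := by
      rw [← hG𝒞]
      exact Set.subset_sUnion_of_mem hT'𝒞
    rcases hcell T' hT'𝒮 with ⟨j, hj⟩ | ⟨ho, hconv⟩
    · exact Set.mem_iUnion.mpr ⟨j, hj hxT'⟩
    · exfalso
      apply hxT
      have hT'𝒯 : T' ∈ 𝒯 := Finset.mem_filter.mpr ⟨hT'𝒮, hT'G, ho, hconv⟩
      refine Set.mem_iUnion.mpr ⟨𝒯.equivFin ⟨T', hT'𝒯⟩, ?_⟩
      simp only [Equiv.symm_apply_apply]
      exact hxT'
  · obtain ⟨𝒞, h𝒞𝒮, hZ𝒞⟩ :=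
      hadapt (Z i) (Finset.mem_insert_of_mem (Finset.mem_image_of_mem Z (Finset.mem_univ i)))
    by_cases hT𝒞 : ((𝒯.equivFin.symm b : 𝒯) : Set (Fin 1 → ℝ)) ∈ 𝒞
    · left
      rw [← hZ𝒞]
      exact Set.subset_sUnion_of_mem (Finset.mem_coe.mpr hT𝒞)
    · right
      rw [← hZ𝒞, Set.disjoint_sUnion_right]
      intro T'' hT''
      have hT''𝒞 : T'' ∈ 𝒞 := Finset.mem_coe.mp hT''
      exact hpart.pairwiseDisjoint (Finset.mem_coe.mpr (hmem b).1) (Finset.mem_coe.mpr (h𝒞𝒮 hT''𝒞))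
        (fun h => hT𝒞 (h ▸ hT''𝒞))

/-- Auxiliary step `sum_of_mem_relations_of_empty`: sum of mem relations of empty. [bookkeeping] -/
theorem sum_of_mem_relations_of_empty {l : ℕ} (AE : Fin l → KZ.IntegralRep 2)
    (h : ∀ j, ∀ z, z ∉ (AE j).domain) : ∑ j, KZ.of (AE j) ∈ KZ.relations := by
  apply (mk_eq_zero_iff).1
  rw [map_sum]
  exact Finset.sum_eq_zero fun j _ => cl_eq_zero_of_eqOn_zero (AE j) fun z hz => (h j z hz).elim

/-- a compact coordinate interval inside an order-convex `T` -/
private theorem isCompact_coordIcc (a b : ℝ) : IsCompact {x : Fin 1 → ℝ | a ≤ x 0 ∧ x 0 ≤ b} := by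
  have : {x : Fin 1 → ℝ | a ≤ x 0 ∧ x 0 ≤ b} = bpt '' Icc a b := by
    ext x
    constructor
    · intro hx; exact ⟨x 0, ⟨hx.1, hx.2⟩, bpt_apply_zero x⟩
    · rintro ⟨r, hr, rfl⟩; simpa using hr
  rw [this]
  exact isCompact_Icc.image continuous_bpt

/-- **Interval fold.** On an open order-convex `ℚ`-sa `T ⊆ ℝ¹` carrying smooth edges with constant derivative signs, each on
one side of `1`, and continuous coefficients: cut at a rational point and apply `half_bot` / `half_top`. -/
theorem interval_fold {T : Set (Fin 1 → ℝ)} (hT : IsSemialgebraic ℚ T) (hTo : IsOpen T) (hTc : OrdConv T)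
    {l : ℕ} {p u : Fin l → (Fin 1 → ℝ) → ℝ}
    (hp : ∀ j, IsSemialgebraicFunOn ℚ T (p j)) (hu : ∀ j, IsSemialgebraicFunOn ℚ T (u j))
    (hu0 : ∀ j, ∀ x ∈ T, 0 ≤ u j x) (hud : ∀ j, ∀ x ∈ T, DifferentiableAt ℝ (u j) x)
    (hsgn : ∀ j, (∀ x ∈ T, du (u j) x = 0) ∨ (∀ x ∈ T, du (u j) x < 0) ∨ (∀ x ∈ T, 0 < du (u j) x))
    (hone : ∀ j, (∀ x ∈ T, u j x ≤ 1) ∨ (∀ x ∈ T, 1 ≤ u j x))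
    (hpc : ∀ j, ContinuousOn (p j) T)
    (A : Fin l → KZ.IntegralRep 2) (hAd : ∀ j, (A j).domain = KZlog.band T (fun _ => 0) (u j))
    (hAi : ∀ j, EqOn (A j).integrand (fun z => p j (Fin.init z) / (1 + z (Fin.last 1) ^ 2)) (A j).domain)
    (hint : ∀ j, IntegrableOn (fun x => p j x * Real.arctan (u j x)) T)
    {S : ℕ} (f' : Fin S → Fin l → ℤ) (m : Fin S → ℚ) (q' : Fin S → (Fin 1 → ℝ) → ℝ)
    (hrel : ∀ s, ∀ x ∈ T, ∑ j, (f' s j : ℝ) * Real.arctan (u j x) = (m s : ℝ) * Real.pi)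
    (hbud : ∀ x ∈ T, ∑ s, q' s x * (m s : ℝ) = 0)
    (hpq : ∀ j, ∀ x ∈ T, p j x = ∑ s, q' s x * (f' s j : ℝ)) :
    ∑ j, KZ.of (A j) ∈ KZ.relations := by
  rcases T.eq_empty_or_nonempty with hTe | ⟨x₂, hx₂⟩
  · exact sum_of_mem_relations_of_empty A fun j z hz => by
      rw [hAd j, hTe] at hz; exact hz.1
  -- a rational cut point `q ∈ T`
  obtain ⟨q, hqT⟩ :=
    Rat.denseRange_cast.exists_mem_open (isOpen_preimage_bpt hTo) ⟨x₂ 0, mem_preimage_bpt hx₂⟩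
  have hqT' : bpt (q : ℝ) ∈ T := hqT
  have hco : IsSemialgebraicFunOn ℚ T (fun x => x 0) :=
    Literature.NumberTheory.Transcendental.isSemialgebraicFunOn_apply hT 0
  have hqs : SaConst T (q : ℝ) := saConst_ratCast hT q
  -- the two halves
  set Tlo : Set (Fin 1 → ℝ) := {x | x ∈ T ∧ x 0 - (q : ℝ) < 0} with hTlo
  set Thi : Set (Fin 1 → ℝ) := {x | x ∈ T ∧ (q : ℝ) - x 0 < 0} with hThi
  have hlo_sa : IsSemialgebraic ℚ Tlo := by
    have h : IsSemialgebraicFunOn ℚ T (fun x => x 0 - (q : ℝ)) := IsSemialgebraicFunOn.sub_holds hco hqs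
    exact h.isSemialgebraic_sep_neg
  have hhi_sa : IsSemialgebraic ℚ Thi := by
    have h : IsSemialgebraicFunOn ℚ T (fun x => (q : ℝ) - x 0) := IsSemialgebraicFunOn.sub_holds hqs hco
    exact h.isSemialgebraic_sep_neg
  have hlo_o : IsOpen Tlo :=
    hTo.inter (isOpen_lt ((continuous_apply 0).sub continuous_const) continuous_const)
  have hhi_o : IsOpen Thi :=
    hTo.inter (isOpen_lt (continuous_const.sub (continuous_apply 0)) continuous_const)
  have hlo_c : OrdConv Tlo := fun x hx y hy r hxr hry =>
    ⟨hTc x hx.1 y hy.1 r hxr hry, by simp only [bpt_apply]; linarith [hy.2]⟩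
  have hhi_c : OrdConv Thi := fun x hx y hy r hxr hry =>
    ⟨hTc x hx.1 y hy.1 r hxr hry, by simp only [bpt_apply]; linarith [hx.2]⟩
  have hlo_ne : Tlo.Nonempty := by
    obtain ⟨y, hy, hlt⟩ := exists_mem_lt hTo hqT'
    exact ⟨y, hy, by simp only [bpt_apply] at hlt; linarith⟩
  have hhi_ne : Thi.Nonempty := by
    obtain ⟨y, hy, hlt⟩ := exists_mem_gt hTo hqT'
    exact ⟨y, hy, by simp only [bpt_apply] at hlt; linarith⟩
  have hloT : Tlo ⊆ T := fun x hx => hx.1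
  have hhiT : Thi ⊆ T := fun x hx => hx.1
  -- restriction of the pointwise hypotheses to a subset
  have restr_sgn : ∀ {T' : Set (Fin 1 → ℝ)}, T' ⊆ T → ∀ j, (∀ x ∈ T', du (u j) x = 0) ∨
      (∀ x ∈ T', du (u j) x < 0) ∨ (∀ x ∈ T', 0 < du (u j) x) := fun hs j =>
    (hsgn j).imp (fun h x hx => h x (hs hx)) fun h => h.imp (fun h x hx => h x (hs hx)) (fun h x hx => h x (hs hx))
  have restr_one : ∀ {T' : Set (Fin 1 → ℝ)}, T' ⊆ T → ∀ j, (∀ x ∈ T', u j x ≤ 1) ∨ (∀ x ∈ T', 1 ≤ u j x) :=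
    fun hs j => (hone j).imp (fun h x hx => h x (hs hx)) (fun h x hx => h x (hs hx))
  -- local integrability of the coefficients on compact coordinate intervals inside `T`
  have hKint : ∀ j (a b : ℝ), bpt a ∈ T → bpt b ∈ T → IntegrableOn (p j) {x : Fin 1 → ℝ | a ≤ x 0 ∧ x 0 ≤ b} := by
    intro j a b ha hb
    have hKT : {x : Fin 1 → ℝ | a ≤ x 0 ∧ x 0 ≤ b} ⊆ T := fun x hx => by
      rw [← bpt_apply_zero x]
      exact hTc (bpt a) ha (bpt b) hb (x 0) (by simpa using hx.1) (by simpa using hx.2)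
    exact ((hpc j).mono hKT).integrableOn_compact (isCompact_coordIcc a b)
  refine loc u hu A hAd ![Tlo, Thi] (fun e => by fin_cases e; exacts [hlo_sa, hhi_sa])
    (fun e => by fin_cases e; exacts [hloT, hhiT]) ?_ ?_ ?_
  · intro e e' hne
    fin_cases e <;> fin_cases e'
    · exact (hne rfl).elim
    · show Disjoint Tlo Thi
      exact Set.disjoint_left.2 fun x h1 h2 => by linarith [h1.2, h2.2]
    · show Disjoint Thi Tlo
      exact Set.disjoint_left.2 fun x h1 h2 => by linarith [h1.2, h2.2]
    · exact (hne rfl).elim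
  · refine measure_mono_null (fun x hx => ?_) (KZ.volume_setOf_last_eq_zero (n := 0) (q : ℝ))
    obtain ⟨hxT, hxU⟩ := hx
    simp only [mem_iUnion, not_exists] at hxU
    have h0 : x ∉ Tlo := hxU 0
    have h1 : x ∉ Thi := hxU 1
    show x 0 = q
    by_contra hne
    rcases lt_or_gt_of_ne hne with h | h
    · exact h0 ⟨hxT, by linarith⟩
    · exact h1 ⟨hxT, by linarith⟩
  · intro e AE hAEd hAEi
    fin_cases e
    · -- the bottom half `Tlo`: its bottom end is the bad one
      have hAEd' : ∀ j, (AE j).domain = KZlog.band Tlo (fun _ => 0) (u j) := hAEd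
      have hAEi' : ∀ j, EqOn (AE j).integrand (fun z => p j (Fin.init z) / (1 + z (Fin.last 1) ^ 2))
          (AE j).domain := fun j z hz => by
        rw [hAEi j]
        exact hAi j (by rw [hAd j]; rw [hAEd' j] at hz; exact ⟨hz.1.1, hz.2⟩)
      refine half_bot hlo_sa hlo_o hlo_c hlo_ne (fun j => (hp j).mono hloT hlo_sa)
        (fun j => (hu j).mono hloT hlo_sa) (fun j x hx => hu0 j x hx.1) (fun j x hx => hud j x hx.1)
        (restr_sgn hloT) (restr_one hloT) AE hAEd' hAEi' (fun j => (hint j).mono_set hloT) ?_ f' m q'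
        (fun s x hx => hrel s x hx.1) (fun x hx => hbud x hx.1) (fun j x hx => hpq j x hx.1)
      intro j x₁ hx₁
      refine (hKint j (x₁ 0) q (by rw [bpt_apply_zero]; exact hx₁.1) hqT').mono_set fun x hx => ⟨hx.2, ?_⟩
      linarith [hx.1.2]
    · -- the top half `Thi`: its top end is the bad one
      have hAEd' : ∀ j, (AE j).domain = KZlog.band Thi (fun _ => 0) (u j) := hAEd
      have hAEi' : ∀ j, EqOn (AE j).integrand (fun z => p j (Fin.init z) / (1 + z (Fin.last 1) ^ 2))
          (AE j).domain := fun j z hz => by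
        rw [hAEi j]
        exact hAi j (by rw [hAd j]; rw [hAEd' j] at hz; exact ⟨hz.1.1, hz.2⟩)
      refine half_top hhi_sa hhi_o hhi_c hhi_ne (fun j => (hp j).mono hhiT hhi_sa)
        (fun j => (hu j).mono hhiT hhi_sa) (fun j x hx => hu0 j x hx.1) (fun j x hx => hud j x hx.1)
        (restr_sgn hhiT) (restr_one hhiT) AE hAEd' hAEi' (fun j => (hint j).mono_set hhiT) ?_ f' m q'
        (fun s x hx => hrel s x hx.1) (fun x hx => hbud x hx.1) (fun j x hx => hpq j x hx.1)
      intro j x₁ hx₁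
      refine (hKint j q (x₁ 0) hqT' (by rw [bpt_apply_zero]; exact hx₁.1)).mono_set fun x hx => ⟨?_, hx.2⟩
      linarith [hx.1.2]

/-- **Cell fold.** On an open `ℚ`-sa `G ⊆ ℝ¹` with the pointwise angle data, an honest arctangent family sums to a relation:
pass to the smooth locus, then to interval cells with constant derivative signs / sides of `1`, then `interval_fold`. -/
theorem cell_fold {G : Set (Fin 1 → ℝ)} (hG : IsSemialgebraic ℚ G) (_hGo : IsOpen G)
    {l : ℕ} {p u : Fin l → (Fin 1 → ℝ) → ℝ}
    (hp : ∀ j, IsSemialgebraicFunOn ℚ G (p j)) (hu : ∀ j, IsSemialgebraicFunOn ℚ G (u j))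
    (hu0 : ∀ j, ∀ x ∈ G, 0 ≤ u j x)
    (A : Fin l → KZ.IntegralRep 2) (hAd : ∀ j, (A j).domain = KZlog.band G (fun _ => 0) (u j))
    (hAi : ∀ j, EqOn (A j).integrand (fun z => p j (Fin.init z) / (1 + z (Fin.last 1) ^ 2)) (A j).domain)
    (hint : ∀ j, IntegrableOn (fun x => p j x * Real.arctan (u j x)) G)
    {S : ℕ} (f' : Fin S → Fin l → ℤ) (m : Fin S → ℚ) (q' : Fin S → (Fin 1 → ℝ) → ℝ)
    (hrel : ∀ s, ∀ x ∈ G, ∑ j, (f' s j : ℝ) * Real.arctan (u j x) = (m s : ℝ) * Real.pi)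
    (hbud : ∀ x ∈ G, ∑ s, q' s x * (m s : ℝ) = 0)
    (hpq : ∀ j, ∀ x ∈ G, p j x = ∑ s, q' s x * (f' s j : ℝ)) :
    ∑ j, KZ.of (A j) ∈ KZ.relations := by
  classical
  -- the smooth locus
  obtain ⟨G₁, hG₁G, hG₁o, hG₁, husm, hn₁⟩ := exists_open_smooth_subset hG u hu
  obtain ⟨G₀, hG₀G₁, hG₀o, hG₀, hpsm, hn₀⟩ :=
    exists_open_smooth_subset hG₁ p fun j => (hp j).mono hG₁G hG₁
  have hG₀G : G₀ ⊆ G := hG₀G₁.trans hG₁G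
  have hud : ∀ j, ∀ x ∈ G₀, DifferentiableAt ℝ (u j) x := fun j x hx =>
    (((husm j).mono hG₀G₁).differentiableOn (by simp)).differentiableAt (hG₀o.mem_nhds hx)
  have hpc : ∀ j, ContinuousOn (p j) G₀ := fun j => (hpsm j).continuousOn
  have hu₀ : ∀ j, IsSemialgebraicFunOn ℚ G₀ (u j) := fun j => (hu j).mono hG₀G hG₀
  have hp₀ : ∀ j, IsSemialgebraicFunOn ℚ G₀ (p j) := fun j => (hp j).mono hG₀G hG₀
  have hdus : ∀ j, IsSemialgebraicFunOn ℚ G₀ (du (u j)) := fun j =>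
    IsSemialgebraicFunOn.fderiv_apply_single hG₀o (hu₀ j) (hud j) 0
  have hnull : volume (G \ ⋃ _e : Fin 1, G₀) = 0 := by
    rw [Set.iUnion_const]
    refine measure_mono_null (fun x hx => ?_) (measure_union_null hn₁ hn₀)
    by_cases h1 : x ∈ G₁
    · exact Or.inr ⟨h1, hx.2⟩
    · exact Or.inl ⟨hx.1, h1⟩
  refine loc u hu A hAd (fun _ : Fin 1 => G₀) (fun _ => hG₀) (fun _ => hG₀G)
    (fun e e' h => (h (Subsingleton.elim _ _)).elim) hnull fun _ A₀ hA₀d hA₀i => ?_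
  -- sign cells
  have hneg : ∀ j, IsSemialgebraicFunOn ℚ G₀ (fun x => -du (u j) x) := fun j => (hdus j).neg
  have hum1 : ∀ j, IsSemialgebraicFunOn ℚ G₀ (fun x => u j x - 1) := fun j =>
    IsSemialgebraicFunOn.sub_holds (hu₀ j) (saConst_one hG₀)
  set Z : Fin l ⊕ (Fin l ⊕ Fin l) → Set (Fin 1 → ℝ) :=
    Sum.elim (fun j => {x | x ∈ G₀ ∧ du (u j) x < 0})
      (Sum.elim (fun j => {x | x ∈ G₀ ∧ -du (u j) x < 0}) (fun j => {x | x ∈ G₀ ∧ u j x - 1 < 0}))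
    with hZdef
  have hZ : ∀ i, IsSemialgebraic ℚ (Z i) := by
    intro i
    rcases i with j | j | j
    · exact (hdus j).isSemialgebraic_sep_neg
    · exact (hneg j).isSemialgebraic_sep_neg
    · exact (hum1 j).isSemialgebraic_sep_neg
  obtain ⟨B, T, hT, hTdisj, hTnull, hTZ⟩ := interval_cells hG₀ Z hZ
  refine loc u hu₀ A₀ hA₀d T (fun b => (hT b).1) (fun b => (hT b).2.2.2) hTdisj hTnull fun b A₁ hA₁d hA₁i => ?_
  have hTG : T b ⊆ G₀ := (hT b).2.2.2
  have hsgn : ∀ j, (∀ x ∈ T b, du (u j) x = 0) ∨ (∀ x ∈ T b, du (u j) x < 0) ∨ (∀ x ∈ T b, 0 < du (u j) x) := by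
    intro j
    rcases hTZ b (Sum.inl j) with h | h
    · exact Or.inr (Or.inl fun x hx => (h hx).2)
    · rcases hTZ b (Sum.inr (Sum.inl j)) with h' | h'
      · refine Or.inr (Or.inr fun x hx => ?_)
        have h2 : -du (u j) x < 0 := (h' hx).2
        linarith
      · refine Or.inl fun x hx => ?_
        have h1 : ¬ du (u j) x < 0 := fun hlt => Set.disjoint_left.1 h hx ⟨hTG hx, hlt⟩
        have h2 : ¬ -du (u j) x < 0 := fun hlt => Set.disjoint_left.1 h' hx ⟨hTG hx, hlt⟩
        push Not at h1 h2
        linarith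
  have hone : ∀ j, (∀ x ∈ T b, u j x ≤ 1) ∨ (∀ x ∈ T b, 1 ≤ u j x) := by
    intro j
    rcases hTZ b (Sum.inr (Sum.inr j)) with h | h
    · refine Or.inl fun x hx => ?_
      have h2 : u j x - 1 < 0 := (h hx).2
      linarith
    · refine Or.inr fun x hx => ?_
      have h1 : ¬ u j x - 1 < 0 := fun hlt => Set.disjoint_left.1 h hx ⟨hTG hx, hlt⟩
      push Not at h1
      linarith
  have hA₁i' : ∀ j, EqOn (A₁ j).integrand (fun z => p j (Fin.init z) / (1 + z (Fin.last 1) ^ 2))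
      (A₁ j).domain := fun j z hz => by
    rw [hA₁i j, hA₀i j]
    exact hAi j (by rw [hAd j]; rw [hA₁d j] at hz; exact ⟨hG₀G (hTG hz.1), hz.2⟩)
  exact interval_fold (hT b).1 (hT b).2.1 (ordConv_of_convex (hT b).2.2.1) (fun j => (hp₀ j).mono hTG (hT b).1)
    (fun j => (hu₀ j).mono hTG (hT b).1) (fun j x hx => hu0 j x (hG₀G (hTG hx))) (fun j x hx => hud j x (hTG hx))
    hsgn hone (fun j => (hpc j).mono hTG) A₁ hA₁d hA₁i' (fun j => (hint j).mono_set (hTG.trans hG₀G)) f' m q'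
    (fun s x hx => hrel s x (hG₀G (hTG hx))) (fun x hx => hbud x (hG₀G (hTG hx)))
    (fun j x hx => hpq j x (hG₀G (hTG hx)))

end AngleFold
end Summit.KontsevichZagierPeriods.RootDecompRelativeModAbsolute.Rung30571.RegularisedLogLayer.CylLog.Leaf.G13
end
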